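import Mathlib
import Summits.AtomisticToContinuum.Crystallization.Theses.PhononSlackCertificates
import Summits.AtomisticToContinuum.Crystallization.Theorems.PhononSlackCertificatesNearFarGlueRLoose
import Summits.AtomisticToContinuum.Crystallization.Theorems.PhononSlackCertificatesNearFarGlueRLatticeSubset
import Summits.AtomisticToContinuum.Crystallization.Theorems.PhononSlackCertificatesNearFarGlueRHcpSubset
import Summits.AtomisticToContinuum.Crystallization.Theorems.PhononSlackCertificatesNearFarGlueRHcpBoxSubset
import Summits.AtomisticToContinuum.Crystallization.Theorems.NearFarGlueR.Negative.GlueToolkit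
import Summits.AtomisticToContinuum.Crystallization.Theorems.PhononSlackCertificatesNearFarGlueRFibre
import Literature.MathematicalPhysics.StatisticalMechanics.LennardJonesClusters

/-!
# Crux `PhononSlackCertificates.NearFarGlueR` (stmt-AtomisticToContinuum-14970), line `Sketch`:
the target on close-packed pieces DECORATED by loose particles

Continuation lead c3; part 2 of the loose-particle species.  Part 1
(`PhononSlackCertificatesNearFarGlueRLoose`) priced loose particles anywhere; c1/c2
(`latticeSubsetGap`, `hcpSubsetGap`, `hcpBoxSubsetGap`) priced the missing-bond defects of EXACT
sub-configurations of the fcc lattice and of the ideal / relaxed hcp stacking.  The two mechanisms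
are additive (`decorated_gap`): if the particles of a `δ`-separated configuration `x` outside a set
`W` form a class on which the target's inequality holds with constant `c` (for every enumeration of
`Wᶜ`), and every particle of `W` is `g₀`-loose IN `x` (`A_j(x) ≥ −0.711 + g₀`, half-repulsion
functional of part 1), then

  `N·e* + min(c, g₀ / (1 + (3/δ + 1)³)) · #{i : ¬ 1/20-good} ≤ 𝓔_LJ(x)`.

Book-keeping: `𝓔(x) = 𝓔(x|Wᶜ) + cross + ½·double` (restriction identity), the bracket pays
`(−0.711 + g₀)·#W ≥ (e* + g₀)·#W` (`loose_sum_le`, `eStar_le_neg`), the substrate pays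
`#Wᶜ·e* + c·#bad(x|Wᶜ)`; and a bad particle of `x` is in `W`, or within `3/2` of `W`
(`≤ (3/δ+1)³·#W` of them, `fibre_count`), or already bad in `x|Wᶜ` (`good_of_good_comp`).
Corollaries — the TARGET `CoerciveTwoShellGap` (hence the residual `TightContactGap`) on three new
classes, with explicit constants and no knowledge of `e*`: pieces of ANY shape of the fcc lattice
(`decoratedFcc_gap`, `c = 15/1536`), of the ideal hcp stacking (`decoratedHcp_gap`, `15/1536`) and
of the relaxed hcp stacking with axial spacing in the box `[39a/50, 17a/20]`
(`decoratedHcpBox_gap`, `1/150`), each decorated by arbitrarily many loose particles — adatoms and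
small ad-islands on the facets, vapour around the crystal, loose junk inside voids, hot
(over-compressed) intruders.  Registered sub-goal `stub_decoratedGap` of the crux item.
All `[folklore]`.
-/

noncomputable section

namespace Summit.AtomisticToContinuum.Crystallization.Theorems.PhononSlackCertificatesNearFarGlueR

open Literature.MathematicalPhysics.StatisticalMechanics
open Literature.Geometry.DiscreteGeometry
open Summit.AtomisticToContinuum.Crystallization.Theses.PhononSlackCertificates
open Summit.AtomisticToContinuum.Crystallization.Theorems.ChargedEnergyGapNegative (eStar)
open Summit.AtomisticToContinuum.Crystallization.Theorems.OnePercentFccRung (eStar_le_neg)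
open Summit.AtomisticToContinuum.Crystallization.Theorems.NearFarGlueRNegative
  (good_of_good_comp fibre_count)
open Summit.AtomisticToContinuum.Crystallization.Theorems.LayeredLawsSelectHcp.Negative.FccLattice
  (fccD3)
open scoped BigOperators

/-! ## §1 Counting: bad particles of the decorated configuration -/

/-- **Bad-count transfer.**  For an enumeration `f` of `Wᶜ` in a `δ`-separated configuration:
`#bad(x) ≤ #bad(x ∘ f) + (1 + (3/δ+1)³)·#W` — a bad particle of `x` lies in `W`, or within `3/2` of a
particle of `W` (fibre count), or is bad already in the sub-configuration (goodness transfer).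
[folklore] -/
theorem card_bad_le_decorated {N K : ℕ} (x : Fin N → EuclideanSpace ℝ (Fin 3)) {δ : ℝ} (hδ : 0 < δ)
    (hsep : ∀ i j : Fin N, i ≠ j → δ ≤ dist (x i) (x j)) (W : Finset (Fin N)) (f : Fin K ↪ Fin N)
    (hmap : Finset.univ.map f = Wᶜ) :
    (Nat.card {i : Fin N // ¬ IsTwoShellGood (1 / 20) (47 / 50) 1 x i} : ℝ) ≤
      (Nat.card {k : Fin K // ¬ IsTwoShellGood (1 / 20) (47 / 50) 1 (x ∘ f) k} : ℝ) +
        (1 + (3 / δ + 1) ^ 3) * (W.card : ℝ) := by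
  classical
  set B := Finset.univ.filter fun i : Fin N => ¬ IsTwoShellGood (1 / 20) (47 / 50) 1 x i with hB
  set BK := Finset.univ.filter fun k : Fin K => ¬ IsTwoShellGood (1 / 20) (47 / 50) 1 (x ∘ f) k
    with hBK
  set S := (Wᶜ).filter fun i : Fin N => ∃ w ∈ W, dist (x i) (x w) ≤ 3 / 2 with hS
  have hcardB : (Nat.card {i : Fin N // ¬ IsTwoShellGood (1 / 20) (47 / 50) 1 x i} : ℝ) = B.card := by
    rw [Nat.card_eq_fintype_card, Fintype.card_subtype]
  have hcardBK : (Nat.card {k : Fin K // ¬ IsTwoShellGood (1 / 20) (47 / 50) 1 (x ∘ f) k} : ℝ) =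
      BK.card := by
    rw [Nat.card_eq_fintype_card, Fintype.card_subtype]
  rw [hcardB, hcardBK]
  -- range of f is Wᶜ
  have hrange : ∀ i : Fin N, i ∈ Wᶜ ↔ i ∈ Set.range f := fun i => by
    rw [← hmap]; simp
  -- fibre count for the spoiled particles
  have hSle : (S.card : ℝ) ≤ (2 * (3 / 2) / δ + 1) ^ 3 * (W.card : ℝ) :=
    fibre_count hδ (by norm_num) x hsep S W fun j hj => by
      obtain ⟨w, hw, hd⟩ := (Finset.mem_filter.1 hj).2
      exact ⟨w, hw, hd⟩
  have h23 : (2 * (3 / 2 : ℝ) / δ + 1) = 3 / δ + 1 := by ring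
  rw [h23] at hSle
  -- cover B by W, S and the image of BK
  have hcover : B ⊆ W ∪ S ∪ BK.map f := by
    intro i hi
    have hbad := (Finset.mem_filter.1 hi).2
    by_cases hiW : i ∈ W
    · exact Finset.mem_union_left _ (Finset.mem_union_left _ hiW)
    · have hiWc : i ∈ Wᶜ := Finset.mem_compl.2 hiW
      by_cases hsp : ∃ w ∈ W, dist (x i) (x w) ≤ 3 / 2
      · exact Finset.mem_union_left _ (Finset.mem_union_right _ (Finset.mem_filter.2 ⟨hiWc, hsp⟩))
      · obtain ⟨k, rfl⟩ := (hrange _).1 hiWc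
        refine Finset.mem_union_right _ (Finset.mem_map.2 ⟨k, Finset.mem_filter.2 ⟨Finset.mem_univ _, ?_⟩, rfl⟩)
        intro hgood
        refine hbad (good_of_good_comp x f k (fun j hj => ?_) hgood)
        have hjW : j ∈ W := by
          by_contra h
          exact hj ((hrange j).1 (Finset.mem_compl.2 h))
        push Not at hsp
        have := hsp j hjW
        rwa [dist_comm] at this
  have h1 : B.card ≤ (W ∪ S).card + (BK.map f).card :=
    (Finset.card_le_card hcover).trans (Finset.card_union_le _ _)
  have h2 : (W ∪ S).card ≤ W.card + S.card := Finset.card_union_le _ _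
  have h3 : (BK.map f).card = BK.card := Finset.card_map _
  have h4 : (B.card : ℝ) ≤ W.card + S.card + BK.card := by
    have : B.card ≤ W.card + S.card + BK.card := by omega
    exact_mod_cast this
  nlinarith [h4, hSle]

/-! ## §2 The decoration theorem -/

/-- **Decoration theorem.**  Let `x` be `δ`-separated, `W` a set of its particles, `c, g₀ ≥ 0`.
If the target's inequality holds with constant `c` on the sub-configuration `x|Wᶜ` (for every
enumeration of `Wᶜ`) and every particle of `W` is `g₀`-loose in `x`, then
`N·e* + min(c, g₀/(1 + (3/δ+1)³))·#bad(x) ≤ 𝓔_LJ(x)`. [folklore] -/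
theorem decorated_gap {N : ℕ} (x : Fin N → EuclideanSpace ℝ (Fin 3)) {δ : ℝ} (hδ : 0 < δ)
    (hsep : ∀ i j : Fin N, i ≠ j → δ ≤ dist (x i) (x j)) (W : Finset (Fin N)) {c g₀ : ℝ}
    (hc : 0 ≤ c) (hg₀ : 0 ≤ g₀)
    (hsub : ∀ (K : ℕ) (f : Fin K ↪ Fin N), Finset.univ.map f = Wᶜ →
      (K : ℝ) * (⨅ Q : PeriodicConfiguration 3, Q.energyPerParticle lennardJones) +
          c * (Nat.card {k : Fin K // ¬ IsTwoShellGood (1 / 20) (47 / 50) 1 (x ∘ f) k} : ℝ) ≤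
        interactionEnergy lennardJones (x ∘ f))
    (hW : ∀ j ∈ W, -(711 / 1000 : ℝ) + g₀ ≤ ∑ k ∈ Finset.univ.erase j,
      (min (lennardJones (dist (x j) (x k))) 0 + (1 / 2 : ℝ) * max (lennardJones (dist (x j) (x k))) 0)) :
    (N : ℝ) * (⨅ Q : PeriodicConfiguration 3, Q.energyPerParticle lennardJones) +
        min c (g₀ / (1 + (3 / δ + 1) ^ 3)) *
          (Nat.card {i : Fin N // ¬ IsTwoShellGood (1 / 20) (47 / 50) 1 x i} : ℝ) ≤
      interactionEnergy lennardJones x := by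
  classical
  set f := (Wᶜ).orderEmbOfFin rfl with hf
  have hmap : Finset.univ.map f.toEmbedding = Wᶜ := Finset.map_orderEmbOfFin_univ Wᶜ rfl
  -- energy book-keeping
  have hid := interactionEnergy_eq_restrict_add x W f.toEmbedding hmap
  have hle := loose_sum_le x W
  have hsum : ∑ j ∈ W, (-(711 / 1000 : ℝ) + g₀) ≤
      ∑ j ∈ W, ∑ k ∈ Finset.univ.erase j,
        (min (lennardJones (dist (x j) (x k))) 0 +
          (1 / 2 : ℝ) * max (lennardJones (dist (x j) (x k))) 0) := Finset.sum_le_sum hW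
  rw [Finset.sum_const, nsmul_eq_mul] at hsum
  have hsubst := hsub _ f.toEmbedding hmap
  have hK : ((Wᶜ.card : ℕ) : ℝ) = (N : ℝ) - (W.card : ℝ) := by
    rw [Finset.card_compl, Fintype.card_fin, Nat.cast_sub (by simpa using W.card_le_univ)]
  have hstar : (⨅ Q : PeriodicConfiguration 3, Q.energyPerParticle lennardJones) ≤ -(711 / 1000 : ℝ) :=
    eStar_le_neg
  have hWstar : (W.card : ℝ) * (⨅ Q : PeriodicConfiguration 3, Q.energyPerParticle lennardJones) ≤
      (W.card : ℝ) * (-(711 / 1000 : ℝ)) := mul_le_mul_of_nonneg_left hstar (Nat.cast_nonneg _)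
  -- counting
  have hcount := card_bad_le_decorated x hδ hsep W f.toEmbedding hmap
  set K₃ : ℝ := (3 / δ + 1) ^ 3 with hK₃
  have hK₃pos : 0 < K₃ := by positivity
  set m : ℝ := min c (g₀ / (1 + K₃)) with hm
  have hm0 : 0 ≤ m := le_min hc (div_nonneg hg₀ (by positivity))
  have hmc : m ≤ c := min_le_left _ _
  have hmg : m * (1 + K₃) ≤ g₀ := by
    have : m ≤ g₀ / (1 + K₃) := min_le_right _ _
    rwa [le_div_iff₀ (by positivity)] at this
  set bN : ℝ := (Nat.card {i : Fin N // ¬ IsTwoShellGood (1 / 20) (47 / 50) 1 x i} : ℝ) with hbN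
  set bK : ℝ := (Nat.card {k : Fin (Wᶜ.card) //
      ¬ IsTwoShellGood (1 / 20) (47 / 50) 1 (x ∘ f.toEmbedding) k} : ℝ) with hbK
  have hbK0 : 0 ≤ bK := Nat.cast_nonneg _
  have hW0 : 0 ≤ (W.card : ℝ) := Nat.cast_nonneg _
  have hcomp : interactionEnergy lennardJones (x ∘ f.toEmbedding) =
      interactionEnergy lennardJones (x ∘ ⇑f) := rfl
  rw [hcomp] at hsubst
  rw [hK] at hsubst
  -- m·bN ≤ m·bK + m(1+K₃)·#W ≤ c·bK + g₀·#W
  have h1 : m * bN ≤ m * bK + m * (1 + K₃) * (W.card : ℝ) := by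
    have := mul_le_mul_of_nonneg_left hcount hm0
    nlinarith [this]
  have h2 : m * bK ≤ c * bK := mul_le_mul_of_nonneg_right hmc hbK0
  have h3 : m * (1 + K₃) * (W.card : ℝ) ≤ g₀ * (W.card : ℝ) := mul_le_mul_of_nonneg_right hmg hW0
  nlinarith [hid, hle, hsum, hsubst, hWstar, h1, h2, h3]

/-- **Registered sub-goal `stub_decoratedGap` of the crux item** (skeleton `Lines/Sketch.lean`, c3):
the decoration theorem in closed form. [folklore] -/
theorem stub_decoratedGap :
    ∀ (N : ℕ) (x : Fin N → EuclideanSpace ℝ (Fin 3)) (δ : ℝ), 0 < δ →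
      (∀ i j : Fin N, i ≠ j → δ ≤ dist (x i) (x j)) →
      ∀ (W : Finset (Fin N)) (c g₀ : ℝ), 0 ≤ c → 0 ≤ g₀ →
      (∀ (K : ℕ) (f : Fin K ↪ Fin N), Finset.univ.map f = Wᶜ →
        (K : ℝ) * (⨅ Q : PeriodicConfiguration 3, Q.energyPerParticle lennardJones) +
            c * (Nat.card {k : Fin K // ¬ IsTwoShellGood (1 / 20) (47 / 50) 1 (x ∘ f) k} : ℝ) ≤
          interactionEnergy lennardJones (x ∘ f)) →
      (∀ j ∈ W, -(711 / 1000 : ℝ) + g₀ ≤ ∑ k ∈ Finset.univ.erase j,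
        (min (lennardJones (dist (x j) (x k))) 0 +
          (1 / 2 : ℝ) * max (lennardJones (dist (x j) (x k))) 0)) →
      (N : ℝ) * (⨅ Q : PeriodicConfiguration 3, Q.energyPerParticle lennardJones) +
          min c (g₀ / (1 + (3 / δ + 1) ^ 3)) *
            (Nat.card {i : Fin N // ¬ IsTwoShellGood (1 / 20) (47 / 50) 1 x i} : ℝ) ≤
        interactionEnergy lennardJones x :=
  fun _ x _ hδ hsep W _ _ hc hg₀ hsub hW => decorated_gap x hδ hsep W hc hg₀ hsub hW

/-! ## §3 Three decorated classes -/

/-- **Decorated fcc pieces.**  A `δ`-separated configuration whose particles outside `W` are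
congruent to a subset of the fcc lattice `fccD3 a`, `a ∈ [47/50, 1]` (vacancies, voids, free
surfaces, pieces of any shape), and whose particles in `W` are `g₀`-loose (adatoms, ad-islands,
vapour, loose junk in voids, hot intruders): `N·e* + min(15/1536, g₀/(1+(3/δ+1)³))·#bad ≤ 𝓔_LJ(x)`.
[folklore] -/
theorem decoratedFcc_gap {a : ℝ} (h47 : 47 / 50 ≤ a) (h1 : a ≤ 1) {N : ℕ}
    (x : Fin N → EuclideanSpace ℝ (Fin 3)) {δ : ℝ} (hδ : 0 < δ)
    (hsep : ∀ i j : Fin N, i ≠ j → δ ≤ dist (x i) (x j)) (W : Finset (Fin N))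
    (g : EuclideanSpace ℝ (Fin 3) ≃ᵢ EuclideanSpace ℝ (Fin 3))
    (hL : ∀ j, j ∉ W → g (x j) ∈ (fccD3 a : Set (EuclideanSpace ℝ (Fin 3)))) {g₀ : ℝ} (hg₀ : 0 ≤ g₀)
    (hW : ∀ j ∈ W, -(711 / 1000 : ℝ) + g₀ ≤ ∑ k ∈ Finset.univ.erase j,
      (min (lennardJones (dist (x j) (x k))) 0 + (1 / 2 : ℝ) * max (lennardJones (dist (x j) (x k))) 0)) :
    (N : ℝ) * (⨅ Q : PeriodicConfiguration 3, Q.energyPerParticle lennardJones) +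
        min (15 / 1536) (g₀ / (1 + (3 / δ + 1) ^ 3)) *
          (Nat.card {i : Fin N // ¬ IsTwoShellGood (1 / 20) (47 / 50) 1 x i} : ℝ) ≤
      interactionEnergy lennardJones x := by
  refine decorated_gap x hδ hsep W (by norm_num) hg₀ (fun K f hmap => ?_) hW
  have hinj : Function.Injective (x ∘ f) := (fibre_injective_of_separated hδ hsep).comp f.injective
  refine latticeSubsetGap_of_isometry h47 h1 (x ∘ f) hinj g fun k => hL (f k) fun hk => ?_
  have : f k ∈ Wᶜ := by rw [← hmap]; exact Finset.mem_map_of_mem f (Finset.mem_univ k)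
  exact Finset.mem_compl.1 this hk

/-- **Decorated ideal hcp pieces** (the conjectured Lennard-Jones ground-state structure, not a
lattice): particles outside `W` congruent to a subset of the ideal stacking `hcpStacking a h`,
`a ∈ [47/50, 1]`, `h² = ⅔a²`; particles in `W` `g₀`-loose:
`N·e* + min(15/1536, g₀/(1+(3/δ+1)³))·#bad ≤ 𝓔_LJ(x)`. [folklore] -/
theorem decoratedHcp_gap {a h : ℝ} (h47 : 47 / 50 ≤ a) (h1 : a ≤ 1) (h0 : 0 < h)
    (hh : h ^ 2 = 2 / 3 * a ^ 2) {N : ℕ}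
    (x : Fin N → EuclideanSpace ℝ (Fin 3)) {δ : ℝ} (hδ : 0 < δ)
    (hsep : ∀ i j : Fin N, i ≠ j → δ ≤ dist (x i) (x j)) (W : Finset (Fin N))
    (g : EuclideanSpace ℝ (Fin 3) ≃ᵢ EuclideanSpace ℝ (Fin 3))
    (hL : ∀ j, j ∉ W → g (x j) ∈ hcpStacking a h) {g₀ : ℝ} (hg₀ : 0 ≤ g₀)
    (hW : ∀ j ∈ W, -(711 / 1000 : ℝ) + g₀ ≤ ∑ k ∈ Finset.univ.erase j,
      (min (lennardJones (dist (x j) (x k))) 0 + (1 / 2 : ℝ) * max (lennardJones (dist (x j) (x k))) 0)) :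
    (N : ℝ) * (⨅ Q : PeriodicConfiguration 3, Q.energyPerParticle lennardJones) +
        min (15 / 1536) (g₀ / (1 + (3 / δ + 1) ^ 3)) *
          (Nat.card {i : Fin N // ¬ IsTwoShellGood (1 / 20) (47 / 50) 1 x i} : ℝ) ≤
      interactionEnergy lennardJones x := by
  refine decorated_gap x hδ hsep W (by norm_num) hg₀ (fun K f hmap => ?_) hW
  have hinj : Function.Injective (x ∘ f) := (fibre_injective_of_separated hδ hsep).comp f.injective
  refine hcpSubsetGap_of_isometry h47 h1 h0 hh (x ∘ f) hinj g fun k => hL (f k) fun hk => ?_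
  have : f k ∈ Wᶜ := by rw [← hmap]; exact Finset.mem_map_of_mem f (Finset.mem_univ k)
  exact Finset.mem_compl.1 this hk

/-- **Decorated relaxed hcp pieces**: particles outside `W` congruent to a subset of the stacking
`hcpStacking a h` with ANY axial spacing in the route's box, `a ∈ [47/50, 1]`,
`h ∈ [39a/50, 17a/20]`; particles in `W` `g₀`-loose:
`N·e* + min(1/150, g₀/(1+(3/δ+1)³))·#bad ≤ 𝓔_LJ(x)`. [folklore] -/
theorem decoratedHcpBox_gap {a h : ℝ} (h47 : 47 / 50 ≤ a) (h1 : a ≤ 1)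
    (hlo : 39 / 50 * a ≤ h) (hhi : h ≤ 17 / 20 * a) {N : ℕ}
    (x : Fin N → EuclideanSpace ℝ (Fin 3)) {δ : ℝ} (hδ : 0 < δ)
    (hsep : ∀ i j : Fin N, i ≠ j → δ ≤ dist (x i) (x j)) (W : Finset (Fin N))
    (g : EuclideanSpace ℝ (Fin 3) ≃ᵢ EuclideanSpace ℝ (Fin 3))
    (hL : ∀ j, j ∉ W → g (x j) ∈ hcpStacking a h) {g₀ : ℝ} (hg₀ : 0 ≤ g₀)
    (hW : ∀ j ∈ W, -(711 / 1000 : ℝ) + g₀ ≤ ∑ k ∈ Finset.univ.erase j,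
      (min (lennardJones (dist (x j) (x k))) 0 + (1 / 2 : ℝ) * max (lennardJones (dist (x j) (x k))) 0)) :
    (N : ℝ) * (⨅ Q : PeriodicConfiguration 3, Q.energyPerParticle lennardJones) +
        min (1 / 150) (g₀ / (1 + (3 / δ + 1) ^ 3)) *
          (Nat.card {i : Fin N // ¬ IsTwoShellGood (1 / 20) (47 / 50) 1 x i} : ℝ) ≤
      interactionEnergy lennardJones x := by
  refine decorated_gap x hδ hsep W (by norm_num) hg₀ (fun K f hmap => ?_) hW
  have hinj : Function.Injective (x ∘ f) := (fibre_injective_of_separated hδ hsep).comp f.injective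
  refine hcpBoxSubsetGap_of_isometry h47 h1 hlo hhi (x ∘ f) hinj g fun k => hL (f k) fun hk => ?_
  have : f k ∈ Wᶜ := by rw [← hmap]; exact Finset.mem_map_of_mem f (Finset.mem_univ k)
  exact Finset.mem_compl.1 this hk

end Summit.AtomisticToContinuum.Crystallization.Theorems.PhononSlackCertificatesNearFarGlueR

end
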